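import Literature.MathematicalPhysics.QuantumFieldTheory.Balaban1983to89.B6Ineq2142KLevelV1L0
import Literature.MathematicalPhysics.QuantumFieldTheory.Balaban1983to89.B6Line3CubeV1L3
import HarnessLib

/-!
# `Balaban1983to89.B6Ineq2142KLevelV1L3` — SUB-ROW G-F3′-L0∕L3 (every odd `L ≥ 3`; plan `lit-balaban-r03/G-F3L0-PLAN.md` §13 cure (B′), joints J9′–J14): the L = 3 twin of
`B6Ineq2142KLevelV1L0` — ONLY its window-dependent assembly theorem is re-declared (joint J14: every window-free declaration of the level-0 twin is consumed BY NAME),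
re-proved verbatim over the L3 parents (canonical chart `B6CubeWindowV1L3`, placement predicate `PlacedC`, the binder `4 ≤ ℓ` DROPPED, `R ≥ 2L²` KEPT).
T. Bałaban, *Propagators and renormalization transformations for lattice gauge theories. II*, Commun. Math. Phys. **96** (1984) 223–250 [Balaban1984PropagatorsII].
No `def … : Prop`, no new fact; standard axioms.  Unit `lit-balaban-r03` (B6 fold owner, r03 gen 37), 2026-08-27; referee ref-4.  NOT summit progress.

statement-level skeleton of published theorems with citation tags; proofs where landed; nothing here is a claim about the Yang–Mills mass gap
-/

namespace Literature.MathematicalPhysics.QuantumFieldTheory.Balaban1983to89.B6Ineq2142KLevelV1L3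

open LatticeFieldCalculus
open B4Reflection242 (boxDom mem_boxDom blk)
open B4ContourShift (supNorm)
open B4TorusKernel.MultiPeriod (torusSupNorm circAbs circAbs_le_abs circAbs_add_mul)
open B5Eq118OneStroke (iterBlockOf iterBlock mem_iterBlock val_iterBlockOf iterBlockOf_zero iterBlockOf_succ bondAvgIter_eq_blockSum
  runSite_mem_iterBlock_tgt iterBlockOf_runSite)
open B6MultiLevelBoxOperator (N0 bigSide one_le_bigSide)
open B6MultiLevelBoxOperatorL0 (Domains)
open B6MultiLevelTorusOperator (N0_eq_bigSide_mul tshift unitVec)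
open B6MultiLevelTorusOperatorL0 (TDomains)
open B6CubeCoeffSizesV1 (torusSupNorm_tshift_unitVec_le)
open B6Geom246MultiLevelBoxL0 (bset blkOf blkOf_val exists_blkOf_eq lev_eq_of_blkOf_eq blkOf_eq_iff_blk)
open B6Geom246MultiLevelTorus (torusSupNorm_neg)
open B6Geom246MultiLevelTorusL0 (geomT bondT TouchT bondT_adj)
open B6GlobalChartV1 (PV toBox toBox_apply blk_toBox)
open B6GlobalChartV1L0 (domT blkV1 iterBlockOf_mem_domT_iff)
open B6ScalarChartV1 (toBox_shift iterBlockOf_eq_iff_blk)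
open B6ScalarChartV1L0 (blkOf_toBox_eq_iff)
open B6MemberOfCubeV1 (torusSupNorm_lt_of_block_shift torusSupNorm_sub_le one_le_N0)
open B6AgreeQaQV1Chart (sitesPerDir_zero_eq_mul iterBlock_nonempty)
open B6RandomWalk (HasMajorant hasMajorant_mono BlockSupp blockPiece sum_blockPiece blockSupp_blockPiece delta3)
open B6Ineq2133TwoScaleV1 (onFun onFun_apply)
open B6SectAOperatorsV1 (QE QsE aE BondIdx BondIdxSpace inner_QsE_left inner_eq_sum)
open B6SectAVectorModelV1 (GE inner_GE_left)
open B6Prop26KLevelSkeletonV1L0 (pref)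
open B6Cover236MultiLevelBlocksL0 (cubes)
open B6CubeWindowV1 (Placed GlobalBand)
open BalabanImbrieJaffe1984to88.BIJ85AxialPropagator411 (BondSpace)
open Literature.MathematicalPhysics.QuantumFieldTheory.Balaban1983to89.B6Ineq2142KLevelV1 (torusSupNorm_lt_of_block_eq cQ cQ_pos cQ_eq cQ_mul_card runSite_injOn pow_le_sitesPerDir iterBlockOf_eq_of_le val_shift_self shift_apply_of_ne iterBlockOf_shift_eq crossings val_runSite_self runSite_apply_of_ne crossings_le iterBlockOf_runSite_mem shift_injective exists_run_start pow_div_pow_le abs_apply_le_of_support delta3_two_mul_nonneg)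
open B6CubeWindowV1L3 (PlacedC)
open Literature.MathematicalPhysics.QuantumFieldTheory.Balaban1983to89.B6Ineq2142KLevelV1L0 (lvl β X ineq2142_of_majorant)
open B6Line3CubeV1L3 (prop26_2136_kLevel_unconditional)

noncomputable section

variable {d ℓ : ℕ} {m K : ℕ} {hd : 1 ≤ d + 1} {hL : Odd (ℓ + 1) ∧ 1 < ℓ + 1}
variable {Mh k R : ℕ} {P' : Fin (d + 1) → ℕ}

/-- **(2.142) FOR THE GENUINE k-LEVEL `QGQ*`** (print p. 248: «From (2.136) we have |(QGQ*)(b, b′)| ≤ O(1)(L^jη)²(L^{j′}η)^{−d}e^{−δ₃d(b,b′)}»):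
with the constant `A` and rate `δ₃ = delta3 α (2σ)` of r03 g22's k-level (2.136)₁ `prop26_2136_kLevel_unconditional` (V1 torus, `k ≥ 2`, `M_h = L^a ≥ 8`,
`M₂ ≤ L·M_h`, `R ≥ 2L²`, `P′ ≥ 5`, `L ≥ 5`, `Placed`, weights in the band (2.16)), for ALL index bonds `i, i′`:
`|⟪e_i, QGQ*e_{i′}⟫| ≤ A′·(L^{j(i)}/c_f)²·(L^{j(i′)D})⁻¹·e^{−δ₃ d_T(β i, β i′)}`, `A′ = 2L^D·A·e^{2δ₃(ℓ+3)}` (`ℓ + 3 = L + 2`).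
[cite: Balaban1984PropagatorsII, (2.142) p.248] -/
theorem ineq2142_kLevel (d ℓ : ℕ) (hd : 1 ≤ d + 1) (hL : Odd (ℓ + 1) ∧ 1 < ℓ + 1) {b₀ b₁ : ℝ} (hb₀ : 0 < b₀) (hb₁ : b₀ ≤ b₁) :
    ∃ σ₁ : ℝ, 0 < σ₁ ∧ ∀ (σ : ℝ), 0 < σ → σ ≤ σ₁ → ∀ (α : ℝ), 0 < α → α ≤ 1 →
    ∃ A' M₂ : ℝ, 0 ≤ A' ∧ 0 < M₂ ∧
    ∀ (m K : ℕ) {Mh k R : ℕ} {P' : Fin (d + 1) → ℕ}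
      (hN : ∀ μ, N0 ℓ Mh k P' μ = (PV d ℓ m K hd hL).sitesPerDir 0) (D : TDomains d ℓ Mh k P' R) (hk : k ≤ m + K) (_ : 2 ≤ k)
      {a : ℕ} (_ : Mh = (ℓ + 1) ^ a) (_ : 8 ≤ Mh) (_ : 2 * (ℓ + 1) ^ 2 ≤ R) (_ : ∀ μ, 5 ≤ P' μ)
      (_ : ∀ c : ↥(cubes D.toDomains), PlacedC ℓ k P' c.1) (_ : M₂ ≤ ((ℓ : ℝ) + 1) * Mh)
      {cf : ℝ} (hcf : cf ≠ 0) {w : BondIdx (domT hN D hk) → ℝ} (hw : ∀ i, 0 < w i) (_ : GlobalBand b₀ b₁ cf w),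
      ∀ i i' : BondIdx (domT hN D hk),
        |X hN D hk hcf hw i i'| ≤ A' * ((((ℓ + 1 : ℕ) : ℝ)) ^ (lvl hN D hk i) / cf) ^ 2 * ((((ℓ + 1 : ℕ) : ℝ) ^ (d + 1)) ^ (lvl hN D hk i'))⁻¹ *
          Real.exp (-(delta3 α (2 * σ) * (geomT D).dist (β hN D hk i) (β hN D hk i'))) := by
  obtain ⟨σ₁, hσ₁, h⟩ := prop26_2136_kLevel_unconditional d ℓ hd hL hb₀ hb₁
  refine ⟨σ₁, hσ₁, fun σ hσ hσ1 α hα hα1 => ?_⟩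
  obtain ⟨A, M₂, hA, hM₂, hmaj⟩ := h σ hσ hσ1 α hα hα1
  have hδ : 0 ≤ delta3 α (2 * σ) := delta3_two_mul_nonneg hα1 hσ
  refine ⟨2 * (((ℓ + 1 : ℕ) : ℝ)) ^ (d + 1) * A * Real.exp (2 * (delta3 α (2 * σ) * ((ℓ : ℝ) + 3))), M₂, by positivity, hM₂, ?_⟩
  intro m K Mh k R P' hN D hk hk2 a hMha hM8 hR2 hP5 hpl hM cf hcf w hw hwb i i'
  have hT := hmaj m K hN D hk hk2 hMha hM8 hR2 hP5 hpl hM hcf hw hwb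
  have hMh : 1 ≤ Mh := le_trans (by norm_num) hM8
  have hP : ∀ μ, 1 ≤ P' μ := fun μ => le_trans (by norm_num) (hP5 μ)
  have hRM : 2 ≤ R * Mh := by
    have hR1 : 1 ≤ R := by
      have h1 : 1 ≤ (ℓ + 1) ^ 2 := Nat.one_le_pow _ _ (by omega)
      omega
    calc 2 ≤ 1 * 8 := by norm_num
      _ ≤ R * Mh := Nat.mul_le_mul hR1 hM8
  exact ineq2142_of_majorant hN D hk hRM hMh hP hcf hw hA hδ hT i i'


end

end Literature.MathematicalPhysics.QuantumFieldTheory.Balaban1983to89.B6Ineq2142KLevelV1L3
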